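import Summits.AtomisticToContinuum.HydrodynamicLimit.Theorems.OneFlightGossipEngineCollisionActivityTailsEntropyTransfer
import HarnessLib

/-!
# `CollisionActivityTails` (stmt-AtomisticToContinuum-13734), line `plaque-thinning-count-ld`, stub ET₂: entropy transfer at time
zero with TWO tagging thresholds (`stub_entropyTransferTT`)

Helper file (`--supports stmt-AtomisticToContinuum-13734`) for the crux
`Summit.AtomisticToContinuum.HydrodynamicLimit.Theses.OneFlightGossipEngine.CollisionActivityTails`, skeleton line
`plaque-thinning-count-ld` (`Cruxes/CollisionActivityTails/Lines/plaque_thinning_count_ld.lean`, v12), registered stub ET₂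
`stub_entropyTransferTT : EquilibriumUntaggedActivityLMGF₂' → UntaggedActivityTails₂'`.

This is the two-threshold PORT of the landed one-threshold stubs `…CollisionActivityTailsEntropyTransfer.stub_entropyTransfer`
(p130202) and its guarded twin `…CollisionActivityTailsPlaqueSplit.stub_entropyTransferDilute`: the single tagging threshold `y`
(guard `y σ³ ≤ 1`) is split into a count threshold `yc` (guard `yc σ³ ≤ 1`) and a kinetic threshold `yk`, both handed from the
conclusion's binders to the hypothesis unchanged. The functional-analytic lemmas are imported from the template module:
`exists_canonicalDensity_le_pow_mul` (pointwise `dλ₀/dG_N ≤ Λ^{N+1}` against the homogeneous reference `G_N = gibbs σ 1 θ₁`,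
`θ₁ = 2 sup θ₀`), `lintegral_withDensity_le_of_exp_moment` (the elementary change-of-measure inequality
`∫ t dP ≤ B + log L + 1` from `p ≤ L q`, `∫ e^t dQ ≤ e^B`) and `budget_arith` (`γ = (log Λ + 2)/η`). The vocabulary `gibbs`,
`Tagged₂`, `uncAct₂` and the two statements of §0 are VERBATIM copies of the skeleton's, over the landed copies `imp`, `relSpeed`,
`scaleRadius`, `ballKinetic`, `rec` of `…CollisionActivityTailsEntropyTransfer` (all copies across the `CollisionActivityTails`
files are syntactically identical; the skeleton bridges definitionally). This file lives in its own namespace.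

References: H. Spohn, *Large Scale Dynamics of Interacting Particles* (1991), Part I §2.3 (local equilibrium vs. equilibrium:
relative entropy of order `N`); C. Kipnis, C. Landim, *Scaling Limits of Interacting Particle Systems* (1999), App. 1 §8 (entropy
inequality). Elementary; recorded here.
-/

noncomputable section

open MeasureTheory Set Filter Topology
open scoped ENNReal

namespace Summit.AtomisticToContinuum.HydrodynamicLimit.Theorems.CollisionActivityTailsEntropyTransferTT

open Literature.MathematicalPhysics.KineticTheory Literature.Analysis.FluidPDE
open Summit.AtomisticToContinuum.HydrodynamicLimit.Theorems.CollisionActivityTailsActivityDomination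
  (Flow Cfg window act tdist nearCount)
open Summit.AtomisticToContinuum.HydrodynamicLimit.Theorems.CollisionActivityTailsNearFieldKineticTails
  (tailFn tailFn_of_lt tailFn_of_le tailFn_nonneg)
open Summit.AtomisticToContinuum.HydrodynamicLimit.Theorems.CollisionActivityTailsEntropyTransfer
  (imp relSpeed scaleRadius ballKinetic exists_canonicalDensity_le_pow_mul lintegral_withDensity_le_of_exp_moment
    budget_arith)

/-! ## §0 Vocabulary (VERBATIM copies of the skeleton's `gibbs`, `Tagged₂`, `uncAct₂` and of the two statements) -/

variable {σ : ℝ} {N : ℕ}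

/-- The global Gibbs law (constant activity `a₀`, zero drift, temperature `θ₀`) — the equilibrium reference `G_N`. -/
def gibbs (σ a₀ θ₀ : ℝ) (N : ℕ) (Φ : Flow σ N) : Measure (Cfg N) :=
  localGibbsLaw σ (fun _ => a₀) (fun _ => 0) (fun _ => θ₀) N Φ

/-- Particle `i` is **tagged with two thresholds** (count threshold `yc`, kinetic threshold `yk`, minimal scale `K`) in the
configuration `cfg`: at some scale `K' ≥ max K 1` the ball of mean occupancy `K'` around `i` holds at least `yc K'` centres OR kinetic
energy (twice) at least `yk K'`. `Tagged y K` of v4–v11 is the diagonal `yc = yk = y` (definitionally). -/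
def Tagged₂ (yc yk : ℝ) (K : ℕ) (cfg : Cfg N) (i : Fin (N + 1)) : Prop :=
  ∃ K' : ℕ, K ≤ K' ∧ 1 ≤ K' ∧
    (yc * K' ≤ (nearCount cfg i (scaleRadius N K') : ℝ) ∨ yk * K' ≤ ballKinetic cfg i (scaleRadius N K'))

open scoped Classical in
/-- **Untagged cold activity** `uncAct₂`: `(σ/τ) Σ |Δv_i|` over the collisions of `i` in `(s, s+w]` with relative speed `≤ Θ` at which
`i` is NOT tagged (two thresholds) — the recurrent branch. -/
def uncAct₂ (Θ yc yk : ℝ) (K : ℕ) (Φ : Flow σ N) (τ s : ℝ) (i : Fin (N + 1)) (z : Cfg N) : ℝ :=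
  σ / τ * Φ.collisionPairSum (Set.Ioc s (s + window τ N))
    (fun t cfg k l => if k = i ∧ relSpeed cfg k l ≤ Θ ∧ ¬ Tagged₂ yc yk K cfg i then imp σ N cfg t k l else 0) z

/-- **The untagged LMGF, two thresholds** (`∀ yc`, `yc σ³ ≤ 1`, `∀ yk`, `∃ V₀`; otherwise verbatim `EquilibriumUntaggedActivityLMGF'`):
under `G_N`, the exponential moment at every tilt `γ` of the SUM of the untagged-activity tails has pressure `≤ δ` once `τ ≥ τ₀(γ, δ)`. -/
def EquilibriumUntaggedActivityLMGF₂' : Prop :=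
  ∀ (a₀ θ₀ : ℝ), 0 < a₀ → 0 < θ₀ → ∃ σ₀ : ℝ, 0 < σ₀ ∧ ∀ σ : ℝ, 0 < σ → σ < σ₀ →
    ∀ yc : ℝ, 0 < yc → yc * σ ^ 3 ≤ 1 → ∀ yk : ℝ, 0 < yk → ∃ V₀ : ℝ, 0 < V₀ ∧ ∀ V : ℝ, V₀ ≤ V → ∀ Θ : ℝ, 0 < Θ → ∀ K : ℕ,
    ∀ γ : ℝ, 0 < γ → ∀ δ : ℝ, 0 < δ → ∃ τ₀ : ℝ, 0 < τ₀ ∧ ∀ τ : ℝ, τ₀ ≤ τ → ∃ N₀ : ℕ, ∀ N : ℕ, N₀ ≤ N →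
    ∀ (Φ : Flow σ N) (s : ℝ), 0 ≤ s →
      AEMeasurable (fun z => ∑ i : Fin (N + 1), tailFn V (uncAct₂ Θ yc yk K Φ τ s i z)) (gibbs σ a₀ θ₀ N Φ) ∧
      ∫⁻ z, ENNReal.ofReal (Real.exp (γ * ∑ i : Fin (N + 1), tailFn V (uncAct₂ Θ yc yk K Φ τ s i z)))
          ∂(gibbs σ a₀ θ₀ N Φ) ≤ ENNReal.ofReal (Real.exp (δ * ((N : ℝ) + 1)))

/-- **The untagged tail statement under the TRUE law, two thresholds** (crux frame; `∀ t < T ∀ yc (yc σ³ ≤ 1) ∀ yk ∃ V₀ ∀ V ∀ Θ ∀ K ∀ η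
∃ τ₀ ∀ τ ∃ N₀ ∀ N ∀ s ≤ t`; otherwise verbatim `UntaggedActivityTails'`). -/
def UntaggedActivityTails₂' : Prop :=
  ∀ (a₀ θ₀ : T3 → ℝ) (u₀ : T3 → V3), Continuous a₀ → Continuous θ₀ → Continuous u₀ →
    (∀ x, 0 < a₀ x) → (∀ x, 0 < θ₀ x) → ∃ σ₀ : ℝ, 0 < σ₀ ∧ ∀ σ : ℝ, 0 < σ → σ < σ₀ →
    ∀ (T : ℝ) (ρ θ : ℝ → T3 → ℝ) (u : ℝ → T3 → V3), IsHardSphereEulerSolution σ T ρ u θ →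
    ∀ Φ : (N : ℕ) → Flow σ N,
    TendstoHydroFieldsAt (fun N => localGibbsLaw σ a₀ u₀ θ₀ N (Φ N)) Φ ρ u θ 0 →
    ∀ t ∈ Set.Ico 0 T, ∀ yc : ℝ, 0 < yc → yc * σ ^ 3 ≤ 1 → ∀ yk : ℝ, 0 < yk →
    ∃ V₀ : ℝ, 0 < V₀ ∧ ∀ V : ℝ, V₀ ≤ V → ∀ Θ : ℝ, 0 < Θ → ∀ K : ℕ,
    ∀ η : ℝ, 0 < η → ∃ τ₀ : ℝ, 0 < τ₀ ∧ ∀ τ : ℝ, τ₀ ≤ τ → ∃ N₀ : ℕ, ∀ N : ℕ, N₀ ≤ N → ∀ s ∈ Set.Icc 0 t,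
      AEMeasurable (fun z => ∑ i : Fin (N + 1), tailFn V (uncAct₂ Θ yc yk K (Φ N) τ s i z))
          (localGibbsLaw σ a₀ u₀ θ₀ N (Φ N)) ∧
      ∫⁻ z, ENNReal.ofReal (((N : ℝ) + 1)⁻¹ * ∑ i : Fin (N + 1), tailFn V (uncAct₂ Θ yc yk K (Φ N) τ s i z))
        ∂(localGibbsLaw σ a₀ u₀ θ₀ N (Φ N)) ≤ ENNReal.ofReal η

/-! ## §1 The stub -/

/-- **STUB ET₂ of line `plaque-thinning-count-ld` (entropy transfer at time zero, two tagging thresholds).** The equilibrium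
exponential moment of the untagged-activity tail sum implies its mean smallness under the true local Gibbs law: reference
`G_N = gibbs σ 1 θ₁ N Φ` with `θ₁ = 2 sup θ₀` (pointwise `dλ₀/dG_N ≤ Λ^{N+1}`, `exists_canonicalDensity_le_pow_mul`), the elementary
entropy inequality `lintegral_withDensity_le_of_exp_moment` with `t = γ F`, `B = N + 1` (`δ = 1`), `L = Λ^{N+1}`, and
`γ = (log Λ + 2)/η`; measurability along `λ₀ ≪ G_N`. The count threshold `yc` with its guard `yc σ³ ≤ 1` and the kinetic threshold
`yk` are handed to the hypothesis unchanged; the Euler solution and the `t = 0` law of large numbers are not used (the estimate is a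
priori). -/
theorem stub_entropyTransferTT : EquilibriumUntaggedActivityLMGF₂' → UntaggedActivityTails₂' := by
  -- adapted from `…CollisionActivityTailsPlaqueSplit.stub_entropyTransferDilute` (two thresholds `yc`, `yk` for one `y`)
  intro hE a₀ θ₀ u₀ ha hθ hu ha0 hθ0
  obtain ⟨θ₁, hθ₁, Λ, hΛ, hdom⟩ := exists_canonicalDensity_le_pow_mul ha hθ hu ha0 hθ0
  obtain ⟨σ₁, hσ₁, hE⟩ := hE 1 θ₁ one_pos hθ₁
  refine ⟨min σ₁ (1 / 2), lt_min hσ₁ (by norm_num), ?_⟩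
  intro σ hσ hσlt T ρ θ u _ Φ _ t _ yc hyc hycσ yk hyk
  have hσ₁' : σ < σ₁ := hσlt.trans_le (min_le_left _ _)
  have hσ2 : σ ≤ 1 / 2 := (hσlt.trans_le (min_le_right _ _)).le
  obtain ⟨V₀, hV₀, hE⟩ := hE σ hσ hσ₁' yc hyc hycσ yk hyk
  refine ⟨V₀, hV₀, ?_⟩
  intro V hV Θ hΘ K η hη
  set κ : ℝ := Real.log Λ with hκ
  have hκ0 : 0 ≤ κ := Real.log_nonneg hΛ
  have hγ : 0 < (κ + 2) / η := by positivity
  obtain ⟨τ₀, hτ₀, hE⟩ := hE V hV Θ hΘ K ((κ + 2) / η) hγ 1 one_pos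
  refine ⟨τ₀, hτ₀, fun τ hτ => ?_⟩
  obtain ⟨N₀, hE⟩ := hE τ hτ
  refine ⟨N₀, fun N hN s hs => ?_⟩
  obtain ⟨hmeas, hmom⟩ := hE N hN (Φ N) s hs.1
  -- the two laws
  have hac : localGibbsLaw σ a₀ u₀ θ₀ N (Φ N) ≪ gibbs σ 1 θ₁ N (Φ N) :=
    localGibbsLaw_absolutelyContinuous_localGibbsLaw continuous_const continuous_const continuous_const
      (fun _ => one_pos) (fun _ => hθ₁) a₀ u₀ θ₀ hσ2 N (Φ N)
  refine ⟨hmeas.mono_ac hac, ?_⟩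
  haveI : IsProbabilityMeasure (localGibbsLaw σ a₀ u₀ θ₀ N (Φ N)) :=
    isProbabilityMeasure_localGibbsLaw ha hθ hu ha0 hθ0 hσ2 N (Φ N)
  -- densities
  set F : Cfg N → ℝ := fun z => ∑ i : Fin (N + 1), tailFn V (uncAct₂ Θ yc yk K (Φ N) τ s i z) with hF
  set p : Cfg N → ℝ := canonicalDensity (Torus.geometry (Fin 3)) (hsDiameter σ N) (N + 1)
    (localGibbsProfile a₀ u₀ θ₀) with hp
  set q : Cfg N → ℝ := canonicalDensity (Torus.geometry (Fin 3)) (hsDiameter σ N) (N + 1)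
    (localGibbsProfile (fun _ => 1) (fun _ => (0 : V3)) (fun _ => θ₁)) with hq
  have hPeq : localGibbsLaw σ a₀ u₀ θ₀ N (Φ N) =
      (volume : Measure (Cfg N)).withDensity fun z => ENNReal.ofReal (p z) := by
    rw [localGibbsLaw_eq]; rfl
  have hQeq : gibbs σ 1 θ₁ N (Φ N) = (volume : Measure (Cfg N)).withDensity fun z => ENNReal.ofReal (q z) := by
    unfold gibbs; rw [localGibbsLaw_eq]; rfl
  have hpm : Measurable p := measurable_canonicalDensity _ _ (measurable_localGibbsProfile ha hθ hu)
  have hqm : Measurable q :=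
    measurable_canonicalDensity _ _ (measurable_localGibbsProfile continuous_const continuous_const continuous_const)
  have hp0 : ∀ z, 0 ≤ p z := fun z =>
    canonicalDensity_nonneg' (fun w => localGibbsProfile_nonneg (fun x => (ha0 x).le) (fun x => (hθ0 x).le) w) _ _ z
  have hq0 : ∀ z, 0 ≤ q z := fun z =>
    canonicalDensity_nonneg' (fun w => localGibbsProfile_nonneg (fun _ => zero_le_one) (fun _ => hθ₁.le) w) _ _ z
  have hL : (1 : ℝ) ≤ Λ ^ (N + 1) := one_le_pow₀ hΛ
  have hpq : ∀ z, p z ≤ Λ ^ (N + 1) * q z := fun z => hdom σ hσ2 N z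
  have hPu : ((volume : Measure (Cfg N)).withDensity fun z => ENNReal.ofReal (p z)) Set.univ ≤ 1 := by
    rw [← hPeq]; exact prob_le_one
  have hB : (0 : ℝ) ≤ 1 * ((N : ℝ) + 1) := by positivity
  have hmom' : ∫⁻ z, ENNReal.ofReal (Real.exp ((κ + 2) / η * F z))
      ∂((volume : Measure (Cfg N)).withDensity fun z => ENNReal.ofReal (q z)) ≤
      ENNReal.ofReal (Real.exp (1 * ((N : ℝ) + 1))) := by
    rw [← hQeq]; exact hmom
  have hkey := lintegral_withDensity_le_of_exp_moment hpm hqm hp0 hq0 hL hpq hPu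
    (fun z => (κ + 2) / η * F z) hB hmom'
  rw [← hPeq, Real.log_pow] at hkey
  -- `(N+1)⁻¹ F = ((N+1) γ)⁻¹ · (γ F)`
  have hsplit : ∀ z, ENNReal.ofReal (((N : ℝ) + 1)⁻¹ * F z) =
      ENNReal.ofReal ((((N : ℝ) + 1) * ((κ + 2) / η))⁻¹) * ENNReal.ofReal ((κ + 2) / η * F z) := fun z => by
    rw [← ENNReal.ofReal_mul (inv_nonneg.2 (by positivity))]
    congr 1
    field_simp
  show ∫⁻ z, ENNReal.ofReal (((N : ℝ) + 1)⁻¹ * F z) ∂(localGibbsLaw σ a₀ u₀ θ₀ N (Φ N)) ≤ ENNReal.ofReal η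
  simp_rw [hsplit]
  rw [lintegral_const_mul' _ _ ENNReal.ofReal_ne_top]
  calc ENNReal.ofReal ((((N : ℝ) + 1) * ((κ + 2) / η))⁻¹) *
        ∫⁻ z, ENNReal.ofReal ((κ + 2) / η * F z) ∂(localGibbsLaw σ a₀ u₀ θ₀ N (Φ N))
      ≤ ENNReal.ofReal ((((N : ℝ) + 1) * ((κ + 2) / η))⁻¹) *
          ENNReal.ofReal (1 * ((N : ℝ) + 1) + ((N + 1 : ℕ) : ℝ) * κ + 1) := mul_le_mul_right hkey _
    _ = ENNReal.ofReal ((((N : ℝ) + 1) * ((κ + 2) / η))⁻¹ *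
          (1 * ((N : ℝ) + 1) + ((N : ℝ) + 1) * κ + 1)) := by
        rw [← ENNReal.ofReal_mul (inv_nonneg.2 (by positivity))]
        push_cast
        ring_nf
    _ ≤ ENNReal.ofReal η := ENNReal.ofReal_le_ofReal (budget_arith hκ0 hη N)

end Summit.AtomisticToContinuum.HydrodynamicLimit.Theorems.CollisionActivityTailsEntropyTransferTT

end
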